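import Summits.AnomalousDissipation.AnomalousDissipation.Theorems.SolenoidalFractalHomogenisationLagrangianStepCellLawVOddGainDefectCubature
import Summits.AnomalousDissipation.AnomalousDissipation.Theorems.SolenoidalFractalHomogenisationLagrangianStepCellLawVEvenCertEnclosures
import Summits.AnomalousDissipation.AnomalousDissipation.Theorems.SolenoidalFractalHomogenisationLagrangianStepCellLawVDesignPoint
import Summits.AnomalousDissipation.AnomalousDissipation.Theorems.SolenoidalFractalHomogenisationLagrangianStepD1Split
import HarnessLib

/-!
# K1L_D `LagrangianRenormalisationStepDesign` (stmt-AnomalousDissipation-27980), `stub_D1_V0R` (ruling D27-1), brick T8a-2: THE REALISED GAIN FORM OF THE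
# CUBATURE WORD IS UNIFORMLY ELLIPTIC — `gainForm W₀ M x k p ≥ (3/10)·c₀·|k|²·|p|²` for `p ⊥ k`, `M ≥ 1/50`, `x ≥ 1`
# (helper; `--kind proof --supports stmt-AnomalousDissipation-27980 --as helper`)

Summits-side helper file of route `SolenoidalFractalHomogenisation` (prover seat `ad-k1l-cellLawV-w1` g7; 0 sorry, no defs, no named facts).  The last
input of the coercivity constant `c₀(W)` of cell finding F-w1g7-1 (with `…SidebandXPsiStarLower`: `symb (psiStar ν S) ≥ (1−ρB)·0.97·gainForm W₀ MB (11/10)/(11/10)`):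
the isotropy of the cubature word in transverse-projector form (`OddGain.slotW_perpSq_sum`: `Σ_s c_s(e_s·κ)²|P_s v|² = c₀|v|²`, an EQUALITY) and the
slot-weight floor `ϑ(½, X) ≥ 3/10` for `X ≥ 30` (`OddGain.le_slotWeight_half`, `OddGain.slotRelax_ge_thirty`).
* `slotWeight_ge_three_tenths` — `X ≥ 30 ⇒ 3/10 ≤ ϑ(½, X)`;
* `slotGainC_div_period_eq` — `slotGainC_s(q,p)/period = slotW q s · perpSq (slotN s) p` for the cubature word;
* `sum_slotGainC_div_period_eq` — `Σ_s slotGainC_s(k,p)/period = c₀·|k|²·|p|²` for `p ⊥ k`;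
* **`gainForm_cubatureWord_ge`** — `(3/10)·c₀·(Σkᵢ²)(Σpᵢ²) ≤ gainForm W₀ M x k p` for `p ⊥ k`, `1/50 ≤ M`, `1 ≤ x`.
NOT a proof of any registered stub, of K1L_D, or of anomalous dissipation; rung F-D1.A0 infrastructure.
-/

set_option linter.dupNamespace false

noncomputable section

namespace Summit.AnomalousDissipation.AnomalousDissipation.Theorems.SolenoidalFractalHomogenisation.LagrangianStep.Sideband

open Set Matrix Finset
open Summit.AnomalousDissipation.AnomalousDissipation.Theorems
open Summit.AnomalousDissipation.AnomalousDissipation.Theorems.SolenoidalFractalHomogenisation.LagrangianStep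
open Summit.AnomalousDissipation.AnomalousDissipation.Theorems.SolenoidalFractalHomogenisation.LagrangianStep.OddGain
open Summit.AnomalousDissipation.AnomalousDissipation.Theorems.SolenoidalFractalHomogenisation.LagrangianStep.WCrossing (slotGainC_nonneg)
open Summit.AnomalousDissipation.AnomalousDissipation.Theorems.SolenoidalFractalHomogenisation.PermissibleCarrier (period_pos)
open Literature.Analysis Literature.Analysis.FluidPDE Literature.Analysis.FunctionSpaces

/-! ## §1 The slot-weight floor -/

/-- **`ϑ(½, X) ≥ 3/10` for `X ≥ 30`.** [folklore] -/
theorem slotWeight_ge_three_tenths {X : ℝ} (hX : 30 ≤ X) : 3 / 10 ≤ slotWeight (1 / 2) X := by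
  have h := le_slotWeight_half hX
  have hX0 : 0 < X := by linarith
  have h1 : 4 / X ^ 2 ≤ 4 / 900 := by
    apply div_le_div_of_nonneg_left (by norm_num) (by norm_num)
    nlinarith
  have h2 : 0 ≤ 12 / X ^ 3 - 16 * (1 / (27 / 10 : ℝ) ^ 15) / X ^ 3 := by
    rw [← sub_div]
    apply div_nonneg _ (by positivity)
    norm_num
  linarith

/-! ## §2 The realised gain form of the cubature word against its isotropy -/

/-- Per slot: `slotGainC_s(q,p)/period = slotW q s · perpSq (slotN s) p` (cubature word). [folklore] -/
theorem slotGainC_div_period_eq (s : Fin 26) (q p : Fin 3 → ℝ) :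
    slotGainC (cubatureWord.phase s) q p / cubatureWord.period = slotW q s * perpSq (slotN s) p := by
  unfold slotGainC slotW slotCoef perpSq slotN
  have hc : ∑ x, mhat (cubatureWord.phase s) x * p x = ∑ x, p x * mhat (cubatureWord.phase s) x :=
    Finset.sum_congr rfl fun x _ => mul_comm _ _
  simp only [dotProduct, sq]
  rw [hc]
  ring

/-- **`Σ_s slotGainC_s(k,p)/period = c₀·|k|²·|p|²` for `p ⊥ k`** (isotropy of the cubature word). [folklore] -/
theorem sum_slotGainC_div_period_eq (k p : Fin 3 → ℝ) (hkp : ∑ i, p i * k i = 0) :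
    ∑ s, slotGainC (cubatureWord.phase s) k p / cubatureWord.period = c0 * (∑ i, k i ^ 2) * (∑ i, p i ^ 2) := by
  simp_rw [slotGainC_div_period_eq]
  by_cases hk : ∑ i, k i ^ 2 = 0
  · -- `k = 0`: both sides vanish
    have hki : ∀ i, k i = 0 := fun i => by
      have := Finset.sum_eq_zero_iff_of_nonneg (fun j _ => sq_nonneg (k j)) |>.1 hk i (Finset.mem_univ i)
      exact pow_eq_zero_iff (n := 2) (by norm_num) |>.1 this
    have hW : ∀ s, slotW k s = 0 := fun s => by
      unfold slotW; simp [hki]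
    simp [hW, hk]
  · -- normalise `κ = k/|k|`
    have hkpos : 0 < ∑ i, k i ^ 2 := lt_of_le_of_ne (Finset.sum_nonneg fun i _ => sq_nonneg (k i)) (Ne.symm hk)
    set r := Real.sqrt (∑ i, k i ^ 2) with hr
    have hr0 : 0 < r := Real.sqrt_pos.2 hkpos
    have hr2 : r ^ 2 = ∑ i, k i ^ 2 := Real.sq_sqrt hkpos.le
    set κ : Fin 3 → ℝ := fun i => k i / r with hκ
    have hκ1 : κ ⬝ᵥ κ = 1 := by
      simp only [dotProduct, hκ]
      rw [show ∑ i, k i / r * (k i / r) = (∑ i, k i ^ 2) / r ^ 2 from by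
        rw [Finset.sum_div]; exact Finset.sum_congr rfl fun i _ => by field_simp]
      rw [hr2, div_self hk]
    have hpκ : p ⬝ᵥ κ = 0 := by
      simp only [dotProduct, hκ, mul_div_assoc', ← Finset.sum_div, hkp, zero_div]
    have hWk : ∀ s, slotW k s = r ^ 2 * slotW κ s := fun s => by
      unfold slotW
      have : ∑ a, (cubatureWord.phase s).e a * k a = r * ∑ a, (cubatureWord.phase s).e a * κ a := by
        rw [Finset.mul_sum]; exact Finset.sum_congr rfl fun a _ => by rw [hκ]; field_simp
      rw [this]; ring
    have hiso := slotW_perpSq_sum κ p hκ1 hpκ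
    calc ∑ s, slotW k s * perpSq (slotN s) p = r ^ 2 * ∑ s, slotW κ s * perpSq (slotN s) p := by
          rw [Finset.mul_sum]; exact Finset.sum_congr rfl fun s _ => by rw [hWk s]; ring
      _ = c0 * (∑ i, k i ^ 2) * (∑ i, p i ^ 2) := by
          rw [hiso, hr2, dotProduct]
          simp only [sq]
          ring

/-- **THE REALISED GAIN FORM OF THE CUBATURE WORD IS UNIFORMLY ELLIPTIC**: for `1/50 ≤ M`, `1 ≤ x` and every transverse pair `p ⊥ k`,
`(3/10)·c₀·(Σᵢkᵢ²)·(Σᵢpᵢ²) ≤ gainForm cubatureWord M x k p`. [folklore] -/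
theorem gainForm_cubatureWord_ge {M x : ℝ} (hM : 1 / 50 ≤ M) (hx : 1 ≤ x) (k p : Fin 3 → ℝ) (hkp : ∑ i, p i * k i = 0) :
    3 / 10 * c0 * (∑ i, k i ^ 2) * (∑ i, p i ^ 2) ≤ gainForm cubatureWord M x k p := by
  have hterm : ∀ s, 3 / 10 * (slotGainC (cubatureWord.phase s) k p / cubatureWord.period) ≤
      slotWeight cubatureWord.ramp (4 * Real.pi ^ 2 * ‖Torus.latticeVec (cubatureWord.phase s).m‖ ^ 2 * M * (cubatureWord.phase s).τ * x) *
        slotGainC (cubatureWord.phase s) k p / cubatureWord.period := by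
    intro s
    have h30 : 30 ≤ 4 * Real.pi ^ 2 * ‖Torus.latticeVec (cubatureWord.phase s).m‖ ^ 2 * M * (cubatureWord.phase s).τ * x := by
      have h := slotRelax_ge_thirty hM s
      nlinarith
    have hw : 3 / 10 ≤ slotWeight cubatureWord.ramp (4 * Real.pi ^ 2 * ‖Torus.latticeVec (cubatureWord.phase s).m‖ ^ 2 * M * (cubatureWord.phase s).τ * x) := by
      rw [show cubatureWord.ramp = 1 / 2 from rfl]; exact slotWeight_ge_three_tenths h30
    have hg : 0 ≤ slotGainC (cubatureWord.phase s) k p / cubatureWord.period :=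
      div_nonneg (slotGainC_nonneg _ k p) (period_pos cubatureWord).le
    rw [mul_div_assoc]
    exact mul_le_mul_of_nonneg_right hw hg
  calc 3 / 10 * c0 * (∑ i, k i ^ 2) * (∑ i, p i ^ 2) = 3 / 10 * ∑ s, slotGainC (cubatureWord.phase s) k p / cubatureWord.period := by
        rw [sum_slotGainC_div_period_eq k p hkp]; ring
    _ = ∑ s, 3 / 10 * (slotGainC (cubatureWord.phase s) k p / cubatureWord.period) := by rw [Finset.mul_sum]
    _ ≤ _ := Finset.sum_le_sum fun s _ => hterm s

end Summit.AnomalousDissipation.AnomalousDissipation.Theorems.SolenoidalFractalHomogenisation.LagrangianStep.Sideband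

end
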